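import Literature.AnabelianGeometry.EtaleTheta.SettingModelTateZClass
import Literature.AnabelianGeometry.EtaleTheta.SettingModelTateKummerData
import Literature.AnabelianGeometry.EtaleTheta.SettingModelTateDeckRelation
import Literature.AnabelianGeometry.EtaleTheta.SettingModelTateThetaOddShear
import Literature.AnabelianGeometry.EtaleTheta.KummerDataOfCoreSection
import HarnessLib

/-!
# The STAGE-2 («Tate shear») model of [EtTh] §1 (R78), F7q part 2a: LEVEL ARITHMETIC of the deck conjugation
# `σ₀ = (a, 1)` and of the `Π^tp_Y/Π^tp_Ÿ`-generator `β = (b, 1)` on `Π^tp_Y`; the Kummer cocycle of `q̈`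

S. Mochizuki, *The étale theta function and its Frobenioid-theoretic manifestations*, Publ. RIMS **45** (2009)
[EtTh], §1, Prop. 1.5 (iii), PRIMS PDF p. 23 ("on which `a ∈ Z` acts as follows: `η̈^Θ ↦ η̈^Θ − 2a·log(Ü) −
(a²/2)·log(q_X) + log(O^×_K̈)`, `log(Ü) ↦ log(Ü) + a·log(q_X)/2 + log(O^×_K̈)`") [cite: MochizukiEtTh2009, Prop 1.5 (iii) p.23].
Layer L2 of the abc-iut cell, seat abc-iut-L2-t6 (gen 6), R78 cluster hand #4, **F7q** part 2a. PROOF-ONLY (no definition,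
no instance, no `Prop` fact) over abc-iut-L2-t5's F5q `ThetaSetting.modelχq p i j hj` (`actχq σ = Inn(b^{κ_p(σ)^i}) ∘
shear_{κ_p(σ)^j} ∘ θ_{χ(σ)}`), `levelHom_gfpOf_a`, `levelChar_two_eq_one`, `actχq_bPowGfp`; abc-iut-w5-d249's
`hHat_deckDefectχq` (`ĥ_N(a⁻¹·σ(a)) = (0, κ^j, −κ^i)`); abc-iut-w5-d171's F6q `kummerCoreχq`; abc-iut-L6-d6's `cThetaχq` /
`toThetaq_eq_of_right_eq_one` / `mem_ellKerχq_iff`; abc-iut-L2-t5's `pRoots` / `kappaP` / `kummerZH_cast`; this seat's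
F7q part 1 (`SettingModelTateZClass`: `refReprχq`, `zPartχq`). All consumed BY NAME, nothing restated.

CONTENTS (Heisenberg levels, `x = 0` on `Π^tp_Y`; `g = (γ, τ) ∈ Π^tp_Y`, `ĥ_N(γ) = (0, y, z)`):
* `deckConj_eq` / `inl_inv_mul_mul_inl`: `(γ₀,1)⁻¹ (γ,τ) (γ₀,1) = (γ₀⁻¹ γ·actχq τ(γ₀), τ)`;
* **`hHat_gfpFst_deckConjLeft`**: `ĥ_N(a⁻¹ γ·actχq τ(a)) = (0, y + κ_N^j, z − y − κ_N^i)`; `yCoordχq_deckConj`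
  (`ŷ ↦ ŷ·κ_p^j`); `toTheta_inl_zRepr_deckConj` (`i = 1`: the `z`-part moves by `c^{−ŷ}·c^{−κ_p}`);
* **`hHat_gfpFst_bConjLeft`**: `ĥ_N(b^{−t} γ·actχq τ(b^t)) = (0, y − t_N + (χ(τ)t)_N, z)` — `β` moves ONLY `ŷ`;
* `kumYdd_toKddHat_qddUnit_eq_mk` / `coe_kummerContCocycle_qdd_apply`: the core's Kummer class of `q̈ = p` is the class of
  the cocycle `h ↦ c^{κ_p(aug^Θ h)}` (root system `p^{1/N}` of record, `kummerContMap_apply_eq`);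
* `mem_GtpYdd_modelχq_of_hHat_two_y`, **`GtpY_le_closure_beta_GtpYdd`**: `Π^tp_Y ≤ ⟨β, Π^tp_Ÿ⟩` (`χ ≡ 1 (mod 2)`).
HONEST FRAMING: SEMI-SYNTHETIC model — consistency / non-vacuity evidence for the typed interface ONLY; nothing of [EtTh]
is asserted; typed ≠ proved; no side is taken on [IUTchIII] Cor. 3.12.
-/

noncomputable section

namespace Literature.AnabelianGeometry.EtaleTheta.SettingModel

open Literature.AnabelianGeometry.SemiGraphs _root_.Topology _root_.Function

variable (p : ℕ) [Fact p.Prime] (i j : ℤ)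

/-- `ĥ_N(a) = (1, 0, 0)` read on `gfpFst`. [cite: MochizukiEtTh2009, §1 p.12] -/
theorem hHat_gfpFst_gfpOf_a (N : ℕ+) : hHat N (gfpFst (gfpOf (FreeGroup.of 0))) = ⟨1, 0, 0⟩ :=
  levelHom_gfpOf_a N

/-- `σ₀ = (a, 1)` has degree `1`: `toZ σ₀ = 1` at `modelχq`. [cite: MochizukiEtTh2009, Prop 1.5 (iii) p.23] -/
theorem toZ_inl_gfpOf_a (hj : Even j) :
    (ThetaSetting.modelχq p i j hj).toZ (SemidirectProduct.inl (gfpOf (FreeGroup.of 0))) = Multiplicative.ofAdd 1 := by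
  change (tateTwistData₀ p i j).toZ _ = _
  rw [GfpTwistData₀.toZ_apply, SemidirectProduct.left_inl, gfpSnd_gfpOf, expA_apply, heisHom_of_zero]

/-- `σ₀ = (a, 1)` has trivial Galois component. [cite: MochizukiEtTh2009, Prop 1.5 (iii) p.23] -/
theorem right_inl_gfpOf_a :
    (SemidirectProduct.inl (gfpOf (FreeGroup.of 0)) : PiTpχq p i j).right = 1 := SemidirectProduct.right_inl _

/-- **The deck conjugate**: `σ₀⁻¹ (γ, τ) σ₀ = (a⁻¹ γ · actχq τ (a), τ)`. [cite: MochizukiEtTh2009, Prop 1.5 (iii) p.23] -/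
theorem deckConj_eq (g : PiTpχq p i j) :
    (SemidirectProduct.inl (gfpOf (FreeGroup.of 0)) : PiTpχq p i j)⁻¹ * g *
        SemidirectProduct.inl (gfpOf (FreeGroup.of 0)) =
      ⟨(gfpOf (FreeGroup.of 0))⁻¹ * g.left * actχq p i j g.right (gfpOf (FreeGroup.of 0)), g.right⟩ := by
  refine SemidirectProduct.ext ?_ ?_
  · simp only [SemidirectProduct.mul_left, SemidirectProduct.inv_left, SemidirectProduct.left_inl,
      SemidirectProduct.right_inl, SemidirectProduct.mul_right, SemidirectProduct.inv_right, inv_one, map_one,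
      MulAut.one_apply, one_mul]
  · simp only [SemidirectProduct.mul_right, SemidirectProduct.inv_right, SemidirectProduct.right_inl, inv_one,
      one_mul, mul_one]

/-- **Levels of the deck conjugate's `Γ`-part** for `γ` of degree `0` (`ĥ_N(γ) = (0, y, z)`):
`ĥ_N(a⁻¹ γ · actχq τ (a)) = (0, y + κ_N^j, z − y − κ_N^i)` (`a⁻¹ γ a` drops `z` by `y`; the deck defect
`a⁻¹·actχq τ(a)` has levels `(0, κ^j, −κ^i)`). [cite: MochizukiEtTh2009, Prop 1.5 (iii) p.23] -/
theorem hHat_gfpFst_deckConjLeft (N : ℕ+) (σ : GQp p) {γ : Gfp} (hγ : gfpSnd γ = 1) :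
    hHat N (gfpFst ((gfpOf (FreeGroup.of 0))⁻¹ * γ * actχq p i j σ (gfpOf (FreeGroup.of 0)))) =
      ⟨0, (hHat N (gfpFst γ)).y + Multiplicative.toAdd (ZHatLevel.level N (kappaP p σ ^ j)),
        (hHat N (gfpFst γ)).z - (hHat N (gfpFst γ)).y - Multiplicative.toAdd (ZHatLevel.level N (kappaP p σ ^ i))⟩ := by
  have hsplit : (gfpOf (FreeGroup.of 0))⁻¹ * γ * actχq p i j σ (gfpOf (FreeGroup.of 0)) =
      ((gfpOf (FreeGroup.of 0))⁻¹ * γ * gfpOf (FreeGroup.of 0)) *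
        ((gfpOf (FreeGroup.of 0))⁻¹ * actχq p i j σ (gfpOf (FreeGroup.of 0))) := by group
  have hx : (hHat N (gfpFst γ)).x = 0 := levelHom_x_eq_zero hγ
  rw [hsplit, map_mul gfpFst, map_mul (hHat N), hHat_deckDefectχq]
  simp only [map_mul, map_inv, hHat_gfpFst_gfpOf_a]
  ext
  · simp [hx]
  · simp
  · simp [hx]
    ring

/-- **The `y`-coordinate of the deck conjugate**: `ŷ(σ₀⁻¹ g σ₀) = ŷ(g) · κ_p(τ)^j` (additively `ŷ + j·κ_p`) for
`g ∈ Π^tp_Y` with Galois part `τ`. [cite: MochizukiEtTh2009, Prop 1.5 (iii) p.23] -/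
theorem yCoordχq_deckConj {g : PiTpχq p i j} (hg : gfpSnd g.left = 1) :
    yCoordχq p i j ((SemidirectProduct.inl (gfpOf (FreeGroup.of 0)) : PiTpχq p i j)⁻¹ * g *
        SemidirectProduct.inl (gfpOf (FreeGroup.of 0))) = yCoordχq p i j g * kappaP p g.right ^ j := by
  rw [deckConj_eq, yCoordχq_apply, yCoordχq_apply]
  show eHatB (gfpFst ((gfpOf (FreeGroup.of 0))⁻¹ * g.left * actχq p i j g.right (gfpOf (FreeGroup.of 0)))) = _
  refine ext_of_modN fun N => ?_
  rw [map_mul (modN N), ← hHat_y_eq_modN_eHatB, ← hHat_y_eq_modN_eHatB, modN_eq_level N (kappaP p g.right ^ j),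
    hHat_gfpFst_deckConjLeft p i j N g.right hg, ofAdd_add, ofAdd_toAdd]

/-- `ĥ_N(c^t) = (0, 0, t mod N)` for the commutator one-parameter group `cGfpχ`. [cite: MochizukiEtTh2009, §1 p.12] -/
theorem hHat_gfpFst_cGfpχ (N : ℕ+) (t : ZH) :
    hHat N (gfpFst (cGfpχ t)) = ⟨0, 0, Multiplicative.toAdd (ZHatLevel.level N t)⟩ := by
  rw [gfpFst_cGfpχ, hHat_apply_of_cPowSpec _ powHat_commutator_spec, modN_eq_level]

/-- Levels of the `z`-part representative `γ · b^{−ŷ(γ)}` of a degree-`0` element: `(0, 0, z)`.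
[cite: MochizukiEtTh2009, Prop 1.5 p.23] -/
theorem hHat_gfpFst_mul_bPowGfp_inv (N : ℕ+) {γ : Gfp} (hγ : gfpSnd γ = 1) :
    hHat N (gfpFst (γ * (bPowGfp (eHatB (gfpFst γ)))⁻¹)) = ⟨0, 0, (hHat N (gfpFst γ)).z⟩ := by
  have hx : (hHat N (gfpFst γ)).x = 0 := levelHom_x_eq_zero hγ
  have hy : (hHat N (gfpFst γ)).y = Multiplicative.toAdd (ZHatLevel.level N (eHatB (gfpFst γ))) := by
    rw [← modN_eq_level, ← hHat_y_eq_modN_eHatB, toAdd_ofAdd]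
  rw [map_mul gfpFst, map_inv gfpFst, gfpFst_bPowGfp, map_mul (hHat N), map_inv (hHat N), hHat_bPow]
  ext <;> simp [hx, hy]

/-- **The `z`-part of the deck conjugate, in the theta quotient**: for `g = (γ, τ) ∈ Π^tp_Y` at `i = 1`,
`θ(inl(γ′·b^{−ŷ(γ′)})) = θ(inl(γ·b^{−ŷ(γ)})) · c^{−ŷ(g)} · c^{−κ_p(τ)}` where `γ′ = a⁻¹ γ · actχq τ (a)` — levels
`(0, 0, z − y − κ_N)` on both sides. [cite: MochizukiEtTh2009, Prop 1.5 (iii) p.23] -/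
theorem toTheta_inl_zRepr_deckConj {g : PiTpχq p 1 j} (hg : gfpSnd g.left = 1) :
    CurveTheta.toTheta (curveχq p 1 j) (SemidirectProduct.inl
        (((gfpOf (FreeGroup.of 0))⁻¹ * g.left * actχq p 1 j g.right (gfpOf (FreeGroup.of 0))) *
          (bPowGfp (eHatB (gfpFst ((gfpOf (FreeGroup.of 0))⁻¹ * g.left *
            actχq p 1 j g.right (gfpOf (FreeGroup.of 0))))))⁻¹)) =
      CurveTheta.toTheta (curveχq p 1 j) (SemidirectProduct.inl (g.left * (bPowGfp (eHatB (gfpFst g.left)))⁻¹)) *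
        (cThetaχq p 1 j (yCoordχq p 1 j g))⁻¹ * (cThetaχq p 1 j (kappaP p g.right))⁻¹ := by
  have hγ' : gfpSnd ((gfpOf (FreeGroup.of 0))⁻¹ * g.left * actχq p 1 j g.right (gfpOf (FreeGroup.of 0))) = 1 := by
    rw [map_mul, map_mul, map_inv, gfpSnd_actχq, hg, mul_one, inv_mul_cancel]
  set γ' : Gfp := (gfpOf (FreeGroup.of 0))⁻¹ * g.left * actχq p 1 j g.right (gfpOf (FreeGroup.of 0)) with hγ'def
  set A : Gfp := γ' * (bPowGfp (eHatB (gfpFst γ')))⁻¹ with hA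
  set B : Gfp := g.left * (bPowGfp (eHatB (gfpFst g.left)))⁻¹ with hB
  have key : CurveTheta.toTheta (curveχq p 1 j) (SemidirectProduct.inl A) =
      CurveTheta.toTheta (curveχq p 1 j)
        (SemidirectProduct.inl (B * (cGfpχ (yCoordχq p 1 j g))⁻¹ * (cGfpχ (kappaP p g.right))⁻¹)) := by
    refine toThetaq_eq_of_right_eq_one p 1 j _ _ (SemidirectProduct.right_inl _) (SemidirectProduct.right_inl _) ?_
    rw [SemidirectProduct.left_inl, SemidirectProduct.left_inl, mem_closure_commutator₃_iff_forall_hHat]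
    intro N
    have hy : (hHat N (gfpFst g.left)).y = Multiplicative.toAdd (ZHatLevel.level N (eHatB (gfpFst g.left))) := by
      rw [← modN_eq_level, ← hHat_y_eq_modN_eHatB, toAdd_ofAdd]
    have h1 : hHat N (gfpFst A) =
        ⟨0, 0, (hHat N (gfpFst g.left)).z - (hHat N (gfpFst g.left)).y -
          Multiplicative.toAdd (ZHatLevel.level N (kappaP p g.right ^ (1 : ℤ)))⟩ := by
      rw [hA, hHat_gfpFst_mul_bPowGfp_inv N hγ', hγ'def, hHat_gfpFst_deckConjLeft p 1 j N g.right hg]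
    have h2 : hHat N (gfpFst B) = ⟨0, 0, (hHat N (gfpFst g.left)).z⟩ := by
      rw [hB, hHat_gfpFst_mul_bPowGfp_inv N hg]
    simp only [map_mul, map_inv, h1, h2, hHat_gfpFst_cGfpχ, yCoordχq_apply, zpow_one]
    ext
    · simp
    · simp
    · simp [hy]
      ring
  rw [cThetaχq_apply, cThetaχq_apply, key]
  simp only [map_mul, map_inv]

/-- `q̈ = p` at `modelχq`: the unit underlying `toInvYdd qddUnit` IS abc-iut-L2-t5's `pUnit p`.
[cite: MochizukiEtTh2009, §1 p.17] -/
theorem pUnit_eq_toInvYdd_qddUnit (hj : Even j) :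
    pUnit p = (((kummerCoreχq p i j hj).toInvYdd (ThetaSetting.modelχq p i j hj).qddUnit :
      (kummerCoreχq p i j hj).invYdd) : (PadicAlgCl p)ˣ) :=
  Units.ext (by rw [coe_pUnit]; rfl)

/-- `q̈` is fixed by `G_{ℚ_p}`. [cite: MochizukiEtTh2009, §1 p.17] -/
theorem toInvYdd_qddUnit_mem_fixedPoints (hj : Even j) :
    (((kummerCoreχq p i j hj).toInvYdd (ThetaSetting.modelχq p i j hj).qddUnit :
      (kummerCoreχq p i j hj).invYdd) : (PadicAlgCl p)ˣ) ∈
        MulAction.fixedPoints (⊤ : Subgroup (GQp p)) (PadicAlgCl p)ˣ :=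
  pUnit_eq_toInvYdd_qddUnit p i j hj ▸ pUnit_mem_fixedPoints p

/-- **The Kummer class `κ(q̈)` of the stage-2 core is the class of the Kummer COCYCLE of the root system
`p^{1/N}` of record** (abc-iut-L2-t5's `pRoots`, transported to the unit `toInvYdd q̈`; `kummerContMap_apply_eq`).
[cite: MochizukiEtTh2009, Prop 1.5 p.23] -/
theorem kumYdd_toKddHat_qddUnit_eq_mk (hj : Even j) :
    (kummerCoreχq p i j hj).toKummerData.kumYdd
        ((kummerCoreχq p i j hj).toKummerData.toKddHat (ThetaSetting.modelχq p i j hj).qddUnit) =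
      (letI := (ThetaSetting.modelχq p i j hj).unitsAction (kummerCoreχq p i j hj).augTheta
       QuotientGroup.mk ((kummerCoreχq p i j hj).coeff.kummerContCocycle
        ((ThetaSetting.modelχq p i j hj).GtpYdd.map (ThetaSetting.modelχq p i j hj).toTheta)
        ((pRoots p).cast (pUnit_eq_toInvYdd_qddUnit p i j hj))
        ((kummerCoreχq p i j hj).toInvYdd (ThetaSetting.modelχq p i j hj).qddUnit).2
        (fun _ => (kummerCoreχq p i j hj).isOpen_stabilizer' _))) := by
  letI := (ThetaSetting.modelχq p i j hj).unitsAction (kummerCoreχq p i j hj).augTheta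
  change (kummerCoreχq p i j hj).coeff.kummerContMap _ (kummerCoreχq p i j hj).isOpen_stabilizer'
      ((kummerCoreχq p i j hj).toInvYdd (ThetaSetting.modelχq p i j hj).qddUnit) = _
  rw [(kummerCoreχq p i j hj).coeff.kummerContMap_apply_eq _ (kummerCoreχq p i j hj).isOpen_stabilizer' _
    ((pRoots p).cast (pUnit_eq_toInvYdd_qddUnit p i j hj))]
  rfl

/-- **Values of that Kummer cocycle**: at `h ∈ (Π^tp_Ÿ)^Θ` it is `c^{κ_p(aug^Θ h)}`. [cite: MochizukiEtTh2009, Prop 1.5 p.23] -/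
theorem coe_kummerContCocycle_qdd_apply (hj : Even j)
    (h : ↥((ThetaSetting.modelχq p i j hj).GtpYdd.map (ThetaSetting.modelχq p i j hj).toTheta)) :
    (letI := (ThetaSetting.modelχq p i j hj).unitsAction (kummerCoreχq p i j hj).augTheta
     ((((kummerCoreχq p i j hj).coeff.kummerContCocycle
        ((ThetaSetting.modelχq p i j hj).GtpYdd.map (ThetaSetting.modelχq p i j hj).toTheta)
        ((pRoots p).cast (pUnit_eq_toInvYdd_qddUnit p i j hj))
        ((kummerCoreχq p i j hj).toInvYdd (ThetaSetting.modelχq p i j hj).qddUnit).2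
        (fun _ => (kummerCoreχq p i j hj).isOpen_stabilizer' _)).1 h :
          (ThetaSetting.modelχq p i j hj).DeltaTheta) : CurveTheta.GTheta (curveχq p i j))) =
      cThetaχq p i j (kappaP p (CurveTheta.augTheta (curveχq p i j) h.1)) := by
  letI := (ThetaSetting.modelχq p i j hj).unitsAction (kummerCoreχq p i j hj).augTheta
  change ((deltaThetaCoordχq p i j (cycEquiv p (((pRoots p).cast (pUnit_eq_toInvYdd_qddUnit p i j hj)).kummerCocycle
      _ h)) : (CurveTheta.thetaToEll (curveχq p i j)).ker) : CurveTheta.GTheta (curveχq p i j)) = _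
  rw [coe_deltaThetaCoordχq, kappaP_def, ← kummerZH_cast (pRoots p) (pUnit_mem_fixedPoints p)
    (pUnit_eq_toInvYdd_qddUnit p i j hj) (toInvYdd_qddUnit_mem_fixedPoints p i j hj), kummerZH_def]
  congr 2

/-- The `z`-cocycle in the theta quotient: `zPartχq (θ x) = θ(inl(x.left · b^{−ŷ(x)}))`. [cite: MochizukiEtTh2009, Prop 1.5 p.23] -/
theorem zPartχq_toTheta (x : PiTpχq p i j) :
    zPartχq p i j (CurveTheta.toTheta (curveχq p i j) x) =
      CurveTheta.toTheta (curveχq p i j) (SemidirectProduct.inl (x.left * (bPowGfp (eHatB (gfpFst x.left)))⁻¹)) := by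
  rw [zPartχq_def, refLiftχq_def, ← map_inv, ← map_mul, mul_refReprχq_inv_eq_inl, yCoordχq_apply]

/-- Conjugating by `inl γ₀`: `(γ₀, 1)⁻¹ (γ, τ) (γ₀, 1) = (γ₀⁻¹ γ · actχq τ (γ₀), τ)`. [cite: MochizukiEtTh2009, Prop 1.5 (iii) p.23] -/
theorem inl_inv_mul_mul_inl (γ₀ : Gfp) (g : PiTpχq p i j) :
    (SemidirectProduct.inl γ₀ : PiTpχq p i j)⁻¹ * g * SemidirectProduct.inl γ₀ =
      ⟨γ₀⁻¹ * g.left * actχq p i j g.right γ₀, g.right⟩ := by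
  refine SemidirectProduct.ext ?_ ?_
  · simp only [SemidirectProduct.mul_left, SemidirectProduct.inv_left, SemidirectProduct.left_inl,
      SemidirectProduct.right_inl, SemidirectProduct.mul_right, SemidirectProduct.inv_right, inv_one, map_one,
      MulAut.one_apply, one_mul]
  · simp only [SemidirectProduct.mul_right, SemidirectProduct.inv_right, SemidirectProduct.right_inl, inv_one,
      one_mul, mul_one]

/-- **Levels of the `β`-conjugate's `Γ`-part** for `β = (b^s, 1)` and `γ` of degree `0` (`ĥ_N(γ) = (0, y, z)`):
`ĥ_N(b^{−s} γ · actχq τ (b^s)) = (0, y − s_N + (χ(τ)s)_N, z)` — the `z`-coordinate is UNCHANGED.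
[cite: MochizukiEtTh2009, Prop 1.5 (iii) p.23] -/
theorem hHat_gfpFst_bConjLeft (N : ℕ+) (σ : GQp p) (t : ZH) {γ : Gfp} (hγ : gfpSnd γ = 1) :
    hHat N (gfpFst ((bPowGfp t)⁻¹ * γ * actχq p i j σ (bPowGfp t))) =
      ⟨0, (hHat N (gfpFst γ)).y - Multiplicative.toAdd (ZHatLevel.level N t) +
          Multiplicative.toAdd (ZHatLevel.level N (chi p σ t)), (hHat N (gfpFst γ)).z⟩ := by
  have hx : (hHat N (gfpFst γ)).x = 0 := levelHom_x_eq_zero hγ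
  rw [actχq_bPowGfp, cocyclePairHom_right, map_mul gfpFst, map_mul gfpFst, map_inv gfpFst, gfpFst_bPowGfp,
    gfpFst_bPowGfp, map_mul (hHat N), map_mul (hHat N), map_inv (hHat N), hHat_bPow, hHat_bPow]
  ext
  · simp [hx]
  · simp only [Heis.mul_y, Heis.inv_y]
    abel
  · simp [hx]

/-- `(b^t, 1) ∈ Π^tp_Y` (degree `0`) at `modelχq`. [cite: MochizukiEtTh2009, §1 p.13] -/
theorem inl_bPowGfp_mem_GtpY_modelχq (hj : Even j) (t : ZH) :
    (SemidirectProduct.inl (bPowGfp t) : PiTpχq p i j) ∈ (ThetaSetting.modelχq p i j hj).GtpY := by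
  show (tateTwistData₀ p i j).toZ _ = 1
  rw [GfpTwistData₀.toZ_apply, SemidirectProduct.left_inl, gfpSnd_bPowGfp]

/-- **Membership in `Π^tp_Ÿ` from the level-`2` `y`-coordinate** at `modelχq` (`K_2 = J̈_1 = ℚ_p`): an element of
`Π^tp_Y` with `ĥ₂(γ).y = 0` lies in `Π^tp_Ÿ`. [cite: MochizukiEtTh2009, §1 p.17] -/
theorem mem_GtpYdd_modelχq_of_hHat_two_y (hj : Even j) {g : PiTpχq p i j}
    (hg : g ∈ (ThetaSetting.modelχq p i j hj).GtpY) (hy : (hHat 2 (gfpFst g.left)).y = 0) :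
    g ∈ (ThetaSetting.modelχq p i j hj).GtpYdd := by
  have hg0 : gfpSnd g.left = 1 := gfpSnd_left_eq_one_of_mem_gtpY_modelχq p i j hj hg
  refine Subgroup.mem_inf.mpr ⟨?_, ?_⟩
  · show g ∈ YNχq p i j (2 * 1)
    rw [mul_one]
    refine (GfpTwistData₀.mem_YN _).mpr ⟨Subgroup.mem_inf.mpr ⟨hg0, ?_⟩, ?_⟩
    · exact Subgroup.mem_comap.mpr ⟨levelHom_x_eq_zero hg0, hy⟩
    · rw [fieldKN_bot_qModel_two, IntermediateField.fixingSubgroup_bot]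
      exact Subgroup.mem_top _
  · show (ThetaSetting.modelχq p i j hj).aug g ∈ (fieldJddN ⊥ (qModel p) 1).fixingSubgroup
    rw [ThetaSetting.fieldJddN_one, fieldKN_bot_qModel_two, IntermediateField.fixingSubgroup_bot]
    exact Subgroup.mem_top _

/-- In `ℤ/2ℤ`, a non-zero element is `1`. [cite: MochizukiEtTh2009, §1 p.17] -/
theorem zmod_two_eq_one_of_ne_zero {y : ZMod (2 : ℕ+)} (hy : y ≠ 0) : y = 1 := by
  change ZMod 2 at y
  fin_cases y
  · exact absurd rfl hy
  · rfl

/-- **`Π^tp_Y ≤ ⟨β, Π^tp_Ÿ⟩`** at `modelχq` with `β = (b, 1)`: an element of `Π^tp_Y` either has even level-`2`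
`y`-coordinate (so lies in `Π^tp_Ÿ`) or differs from `β` by such an element (`χ ≡ 1 (mod 2)`).
[cite: MochizukiEtTh2009, Prop 1.5 (iii) p.23] -/
theorem GtpY_le_closure_beta_GtpYdd (hj : Even j) :
    (ThetaSetting.modelχq p i j hj).GtpY ≤
      Subgroup.closure ({(SemidirectProduct.inl (bPowGfp (iotaZ (Multiplicative.ofAdd 1))) : PiTpχq p i j)} ∪
        ((ThetaSetting.modelχq p i j hj).GtpYdd : Set (PiTpχq p i j))) := by
  intro g hg
  set β : PiTpχq p i j := SemidirectProduct.inl (bPowGfp (iotaZ (Multiplicative.ofAdd 1))) with hβ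
  by_cases hy : (hHat 2 (gfpFst g.left)).y = 0
  · exact Subgroup.subset_closure (Or.inr (mem_GtpYdd_modelχq_of_hHat_two_y p i j hj hg hy))
  · have hβY : β ∈ (ThetaSetting.modelχq p i j hj).GtpY := inl_bPowGfp_mem_GtpY_modelχq p i j hj _
    have hgb : g * β⁻¹ ∈ (ThetaSetting.modelχq p i j hj).GtpY :=
      (ThetaSetting.modelχq p i j hj).GtpY.mul_mem hg ((ThetaSetting.modelχq p i j hj).GtpY.inv_mem hβY)
    have h1 : Multiplicative.toAdd (ZHatLevel.level 2 (iotaZ (Multiplicative.ofAdd 1))) = 1 := by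
      rw [← modN_eq_level, modN_iotaZ, toAdd_ofAdd, toAdd_ofAdd, Int.cast_one]
    -- `g·β⁻¹ ∈ Π^tp_Ÿ`: its level-2 `y`-coordinate is `y₂(g) − χ₂·1 = 1 − 1 = 0`
    have hmem : g * β⁻¹ ∈ (ThetaSetting.modelχq p i j hj).GtpYdd := by
      refine mem_GtpYdd_modelχq_of_hHat_two_y p i j hj hgb ?_
      rw [hβ, SemidirectProduct.mul_left, SemidirectProduct.inv_left, SemidirectProduct.left_inl,
        SemidirectProduct.right_inl, inv_one, map_one, MulAut.one_apply, map_inv, actχq_bPowGfp,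
        cocyclePairHom_right, map_mul gfpFst, map_inv gfpFst, gfpFst_bPowGfp, map_mul (hHat 2), map_inv (hHat 2),
        hHat_bPow, Heis.mul_y, Heis.inv_y, zmod_two_eq_one_of_ne_zero hy]
      rw [ZHatLevel.toAdd_level_aut, levelChar_two_eq_one, h1]
      decide
    have hfac : g = g * β⁻¹ * β := by rw [inv_mul_cancel_right]
    rw [hfac]
    exact Subgroup.mul_mem _ (Subgroup.subset_closure (Or.inr hmem)) (Subgroup.subset_closure (Or.inl rfl))

end Literature.AnabelianGeometry.EtaleTheta.SettingModel

end
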